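/-
Copyright (c) 2026. All rights reserved.
Released under Apache 2.0 license as described in the file LICENSE.
-/
import Summits.NavierStokesRegularity.FluidComputer.RowSwitchSound
import HarnessLib

/-!
# Re-entry checker: a coordinate box of start states lies in a row's start tube box

HONEST FRAMING (cell `pub-fluidc`, blueprint seat bp3, gen 23): low prior, high value-of-information
experiment on Tao's machine paradigm; NOT a claim that NS blows up. This file is finite-dimensional
bookkeeping for the 9-mode TOY chain (R1-DESIGN §12); it says nothing about Navier–Stokes.

The scale induction `I(n) ⇒ I(n+1)` of the R1 programme closes a loop: the circuit started in a
box of start states reaches a section where the renormalised read-outs land in a box `B'`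
(`RowSection.sectionOK` / `section_sound`), and `B'` together with the designed carrier/lock values
and the quiet-mode box must again be a box of admissible START states, i.e. lie inside row `0`'s
start tube `|z₀(q)|ᵢ ≤ uᵢ/2^P`, where `z₀(q) = A₀ (q − X₀)` are the frame coordinates
(`RowCircuitEnd.z0`). This file is the generic, table-valued Boolean checker of that inclusion
and its soundness:

* `ReBox` — a coordinate box (centre `cen`, radius `rad`, rationals) of 9-mode states;
* `RowData.reentryOK r B` — for every slot `i`, `Σ_b |A0I.lo i.succ b| · (|cen_b − x̂_b(0)| + rad_b) ≤ u i.succ`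
  (exact rational arithmetic; the Lean frame `canon` IS the lower-endpoint matrix `loM`, so no
  interval widths enter);
* `reentry_sound` — if it passes, every real state `q` with `|q_b − cen_b| ≤ rad_b` satisfies
  `|Σ_b (canon).Av 0 i.succ b · (q_b − x̂_b(0))| ≤ r.ubR 0 i` for every slot `i` — literally the
  hypothesis `hbox` of `RowChain.circuit_enclosure_from` / `circuit_section_from` when `r = row 0`.

No `sorry`, no new axioms, no `native_decide` (the instance for the chain of record is decided in
`RowCircuitReentry.lean`).
-/

namespace Summit.NavierStokesRegularity.FluidComputer

open Literature.Analysis.FluidPDE.FluidComputer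

namespace RowCheck

open DIVec ChainField Finset Real Set Matrix

/-- A coordinate box of 9-mode states: centre and radius per mode (rationals). [folklore] -/
structure ReBox where
  /-- centre per mode -/
  cen : Fin 9 → ℚ
  /-- radius per mode -/
  rad : Fin 9 → ℚ

namespace RowData

variable {r : RowData}

/-- **Re-entry checker**: the box `B` lies in the row's start tube box, slot by slot, with the
centre offset `|cen_b − x̂_b(0)|` charged in full (exact rationals). [folklore] -/
def reentryOK (r : RowData) (B : ReBox) : Bool :=
  decide (∀ i : Fin 8, ∑ b : Fin 9, |((r.A0I i.succ b).lo : ℚ)| *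
    (|B.cen b - (r.CQ b).getD 0 0| + B.rad b) ≤ (r.u i.succ : ℚ))

/-- [folklore] -/
theorem reentryOK_iff (B : ReBox) : r.reentryOK B = true ↔
    ∀ i : Fin 8, ∑ b : Fin 9, |((r.A0I i.succ b).lo : ℚ)| *
      (|B.cen b - (r.CQ b).getD 0 0| + B.rad b) ≤ (r.u i.succ : ℚ) := by
  simp only [reentryOK, decide_eq_true_eq]

/-- The canonical start frame entry is the lower endpoint over `2^P`. [folklore] -/
theorem canon_Av_zero (hf : r.framesOK = true) (i b : Fin 9) :
    (canon hf).Av 0 i b = ((r.A0I i b).lo : ℝ) / 2 ^ r.P := by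
  rw [Av_zero]; rfl

/-- **Soundness of the re-entry checker.** Every state of the box has start-frame coordinates
inside the row's start tube box. [folklore] -/
theorem reentry_sound {B : ReBox} (h : r.reentryOK B = true) (hf : r.framesOK = true)
    {q : Fin 9 → ℝ} (hq : ∀ b, |q b - (B.cen b : ℝ)| ≤ B.rad b) (i : Fin 8) :
    |∑ b, (canon hf).Av 0 i.succ b * (q b - xh r.CQ 0 b)| ≤ r.ubR 0 i := by
  have hP : (0 : ℝ) < 2 ^ r.P := pow_pos two_pos _
  have hrow := (reentryOK_iff B).mp h i
  have hrowR : ∑ b : Fin 9, |((r.A0I i.succ b).lo : ℝ)| *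
      (|(B.cen b : ℝ) - (((r.CQ b).getD 0 0 : ℚ) : ℝ)| + B.rad b) ≤ (r.u i.succ : ℝ) := by
    have := (Rat.cast_le (K := ℝ)).mpr hrow
    push_cast at this
    exact this
  rw [ubR_zero, toR]
  calc |∑ b, (canon hf).Av 0 i.succ b * (q b - xh r.CQ 0 b)|
      ≤ ∑ b, |(canon hf).Av 0 i.succ b * (q b - xh r.CQ 0 b)| := abs_sum_le_sum_abs _ _
    _ = ∑ b, |((r.A0I i.succ b).lo : ℝ)| / 2 ^ r.P * |q b - (((r.CQ b).getD 0 0 : ℚ) : ℝ)| := by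
        refine sum_congr rfl fun b _ => ?_
        rw [canon_Av_zero, xh_zero, abs_mul, abs_div, abs_of_pos hP]
    _ ≤ ∑ b, |((r.A0I i.succ b).lo : ℝ)| / 2 ^ r.P *
          (|(B.cen b : ℝ) - (((r.CQ b).getD 0 0 : ℚ) : ℝ)| + B.rad b) := by
        refine sum_le_sum fun b _ => mul_le_mul_of_nonneg_left ?_ (by positivity)
        calc |q b - (((r.CQ b).getD 0 0 : ℚ) : ℝ)|
            = |(q b - B.cen b) + ((B.cen b : ℝ) - (((r.CQ b).getD 0 0 : ℚ) : ℝ))| := by ring_nf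
          _ ≤ |q b - B.cen b| + |(B.cen b : ℝ) - (((r.CQ b).getD 0 0 : ℚ) : ℝ)| := abs_add_le _ _
          _ ≤ _ := by linarith [hq b]
    _ = (∑ b, |((r.A0I i.succ b).lo : ℝ)| *
          (|(B.cen b : ℝ) - (((r.CQ b).getD 0 0 : ℚ) : ℝ)| + B.rad b)) / 2 ^ r.P := by
        rw [sum_div]; exact sum_congr rfl fun b _ => by ring
    _ ≤ (r.u i.succ : ℝ) / 2 ^ r.P := div_le_div_of_nonneg_right hrowR hP.le

end RowData

end RowCheck

end Summit.NavierStokesRegularity.FluidComputer
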